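/-
Copyright: the b2b-balaban T⁴-continuum CRUX team, row NE7b owner lineage `t4-ne7b-p1` (gen 112). Project licence.
-/
import Summits.QuantumFields.BalabanUV.T4Continuum.Spine.NE7b.OneShotChartSideTwo

/-!
# THE ONE-SHOT CHART FOR EVERY BLOCK SIDE `M ≥ 3`: `‖H_M‖²_η ≤ 0.58^{−d}` (`< 8.84 < 9 ≤ M²` at d = 4) — the near-central alias
# pair for general `M`: `X_M(p′) ≥ Π_μ F_M(p′_μ)` with `F_M(x) ≥ sin²y∕y² + 0.91·sin²y·y²∕(π−y)⁴ ≥ 0.58` (`y = |x|∕2`), a calculus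
# certificate in eight pieces (row NE7b, node U5c; closes the levels `M = 3, 4` and improves all `M ≥ 3`: with (44) EVERY block side
# `M ≥ 2` at d = 4 has `‖H_M‖_η < M = M^{(d−2)∕2}` BY PROOF; Literature B4∕B5∕B6 + Mathlib + (39)–(44); [folklore])

Cell `pub-balaban`, sub-cell `t4`, spine estimate NE7b (`T4WeightBudget.RelWeightBound`; the cell's OWN estimate — NOT PRINTED in
[Bałaban 1983–89], NOT PROVED).  Crux-route work under `Spine/NE7b/` by the row OWNER (`t4-ne7b-p1` gen 112) under FREEZE (0)'s
crux-prover clause (RULING W-ne7bp1-g112-1); NOTHING of Bałaban's is asserted; no `T4Continuum/Support` leaf typed; no `def`; zero `sorry`.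

WHY.  (42) closes the chart letter for `M ≥ 8` (d = 4), (44) for `M = 2`; the level `M = 4` of `L = 2` (and `M = 3` of `L = 3`) remained
(NC-NE7b-β (β0)).  As in (44): `R_k ≥ Π_μ ρ_μ(k_μ)` with `ρ(j) = S_ξ(x)∕S_ξ(x+2πj) ≤ 1` ((40) `Sxir_shift_ge`), so `X_M(p′) ≥
Π_μ Σ_{j<M} u_j(p′_μ)ρ_j(p′_μ)` for EVERY `M`; keeping only the central alias and its mirror (`j = M−1` for `p′_μ > 0`, `j = 1` for
`p′_μ < 0`) the coordinate letter is `A + B = sin²y∕(M²sin²(y∕M)) + sin²y·sin²(y∕M)∕(M²sin⁴((π−y)∕M))`, `y = |p′_μ|∕2 ∈ (0, π∕2]`;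
`M sin(y∕M) ≤ y`, `sin(y∕M) ≥ (y∕M)(1 − (y∕M)²∕6) ≥ 0.954·y∕M` (`M ≥ 3`), `sin((π−y)∕M) ≤ (π−y)∕M` give `A + B ≥ G(y) = sin²y(1∕y² +
0.91·y²∕(π−y)⁴)`, and `G ≥ 0.58` on `(0, π∕2]` by `sin y ≥ y − y³∕6` on `(0, 0.9]` and, on seven pieces `[α, β]` of `[0.9, π∕2]`, by
`sin y ≥ sin α = cos(π∕2 − α) ≥ 1 − (1.5708 − α)²∕2` and the monotonicity of `1∕y²`, `y²∕(π−y)⁴` (rational endpoint checks, `norm_num`).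
Hence `X_M ≥ 0.58^d`, `‖H_M‖²_η ≤ 0.58^{−d}`; d = 4: `8.83… < 9 ≤ M²` for every `M ≥ 3` (truth `≤ 1.76`).

WHAT IS PROVED ([folklore]; `p ∈ [−π,π]^d`, `a > 0`):
* §1 `G_piece`, **`G_ge`** (`0.58 ≤ sin²y(1∕y² + 0.91y²∕(π−y)⁴)` on `(0, π∕2]`), **`core_bound`** (`0.58 ≤ A + B`, `M ≥ 3`).
* §2 `Sxir_shift_pos`, `Rr_ge_prod` (every `M`: `R_k ≥ Π_μ ρ_μ(k_μ)`), **`Xr_ge_prod_letter`** (`X_M(p) ≥ Π_μ Σ_j u_jρ_j`), `letter_ge`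
  (`Σ_j u_j(x)ρ_j(x) ≥ 0.58`, `M ≥ 3`, `|x| ≤ π`), **`Xr_ge_of_three_le`** (`X_M(p) ≥ 0.58^d`).
* §3 **`sum_normSq_G_le_threeUp`** (`Σ_τ‖G_{M,a,0,τ}(p)‖² ≤ M^d (0.58^d)⁻¹ symbR(p)²`), **`tsum_HBZd_sq_le_threeUp`**
  (`((n+1)^d)⁻¹Σ′_z(HB)(z)² ≤ (0.58^d)⁻¹ Σ′_y B(y)²`, `n ≥ 2`), `tsum_HBZd_sq_le_threeUp_d4` (`< 8.84·Σ′B²`: `‖H_M‖_η < 2.98 < 3 ≤ M`),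
  **`chart_letter_d4`** (every `M ≥ 2`: `∃ K < M²` with `(M⁴)⁻¹Σ′(HB)² ≤ K·Σ′B²` — the consumer's letter `K₁ < M^{(d−2)∕2}` met for every side).

NOT HERE (honest): the sharp values (`sup_M ‖H_M‖_η = 1.326` at d = 4); d = 3's threshold `√M` for small `M`; anything of Bałaban's
((A3), NC-NE7b-α UNRULED).  BY-NAME EFFECT ON THE WALL: NONE.  NE7b NOT PRINTED ∕ NOT PROVED; spine PROVED 0∕9; rung (B)+1 on a FINITE torus —
NOT infinite volume, NOT the mass gap, NOT Clay.  HONEST DEPENDENCY: continuum YM on T⁴ ⇐ BetaPertH ∧ nine spine estimates (0∕9 proved).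
-/

set_option autoImplicit false

namespace Summit.QuantumFields.BalabanUV.T4Continuum.NE7b.OneShotChartPairBound

open Finset
open Literature.MathematicalPhysics.QuantumFieldTheory.Balaban1983to89
open B4Strip (ofRealVec Ur uFactorr Er S1r Sxir DeltaXir shiftr Ur_nonneg Sxir_eq S1r_eq uFactorr_nonneg Sxir_nonneg)
open B4StripSums (G)
open B4ContourShift (BZ)
open B6QGQLower276 (X)
open B5Hk165L2Zd (HBZd)
open B6QGQFourier275Zd (symbR Rr Xr Rr_nonneg Xr_ge)
open OneShotChartFibreSum (Sxir_shift_ge)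
open OneShotChartFibreChain (sum_normSq_G_le_div_Xr tsum_HBZd_sq_le_of_fibre)
open OneShotChartSideTwo (prod_le_sum_div_sum)
open scoped Real

noncomputable section

variable {d : ℕ}

/-! ## §1. The calculus certificate: `G(y) = sin²y(1∕y² + 0.91·y²∕(π−y)⁴) ≥ 0.58` on `(0, π∕2]`, and `A + B ≥ G` -/

/-- one piece `[α, β] ⊂ (0, π∕2]`: `G(y) ≥ (1 − (1.5708−α)²∕2)²·(1∕β² + c₂α²∕(3.1416−α)⁴)` (`sin y ≥ sin α = cos(π∕2−α) ≥ 1 − (π∕2−α)²∕2`,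
`1∕y² ≥ 1∕β²`, `y²∕(π−y)⁴ ≥ α²∕(3.1416−α)⁴`). [folklore] -/
theorem G_piece {c₂ α β y : ℝ} (hc₂ : 0 ≤ c₂) (hα : 0 < α) (hαy : α ≤ y) (hyβ : y ≤ β) (hyπ : y ≤ π / 2)
    (hσ : (1.5708 - α) ^ 2 / 2 ≤ 1) :
    (1 - (1.5708 - α) ^ 2 / 2) ^ 2 * (1 / β ^ 2 + c₂ * (α ^ 2 / (3.1416 - α) ^ 4))
      ≤ Real.sin y ^ 2 * (1 / y ^ 2 + c₂ * (y ^ 2 / (π - y) ^ 4)) := by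
  have hπ1 : π < 3.1416 := Real.pi_lt_d4
  have hαπ : α ≤ π / 2 := hαy.trans hyπ
  have h1 : 1 - (1.5708 - α) ^ 2 / 2 ≤ Real.sin α := by
    rw [← Real.cos_pi_div_two_sub]
    refine le_trans ?_ (Real.one_sub_sq_div_two_le_cos)
    have h0 : 0 ≤ π / 2 - α := by linarith
    have h3 : π / 2 - α ≤ 1.5708 - α := by linarith
    have : (π / 2 - α) ^ 2 ≤ (1.5708 - α) ^ 2 := pow_le_pow_left₀ h0 h3 2
    linarith
  have h2 : Real.sin α ≤ Real.sin y :=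
    Real.sin_le_sin_of_le_of_le_pi_div_two (by linarith [Real.pi_pos]) hyπ hαy
  have hσ0 : 0 ≤ 1 - (1.5708 - α) ^ 2 / 2 := by linarith
  have hsin : (1 - (1.5708 - α) ^ 2 / 2) ^ 2 ≤ Real.sin y ^ 2 := pow_le_pow_left₀ hσ0 (h1.trans h2) 2
  have hy0 : 0 < y := lt_of_lt_of_le hα hαy
  have h3 : 1 / β ^ 2 ≤ 1 / y ^ 2 :=
    one_div_le_one_div_of_le (by positivity) (pow_le_pow_left₀ hy0.le hyβ 2)
  have h4 : α ^ 2 / (3.1416 - α) ^ 4 ≤ y ^ 2 / (π - y) ^ 4 := by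
    have hnum : α ^ 2 ≤ y ^ 2 := pow_le_pow_left₀ hα.le hαy 2
    have hden0 : 0 < π - y := by linarith
    have hden : (π - y) ^ 4 ≤ (3.1416 - α) ^ 4 := pow_le_pow_left₀ hden0.le (by linarith) 4
    exact div_le_div₀ (by positivity) hnum (by positivity) hden
  have hh : 1 / β ^ 2 + c₂ * (α ^ 2 / (3.1416 - α) ^ 4) ≤ 1 / y ^ 2 + c₂ * (y ^ 2 / (π - y) ^ 4) :=
    add_le_add h3 (mul_le_mul_of_nonneg_left h4 hc₂)
  have hh0 : 0 ≤ 1 / β ^ 2 + c₂ * (α ^ 2 / (3.1416 - α) ^ 4) := by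
    have : 0 < 3.1416 - α := by linarith
    positivity
  exact mul_le_mul hsin hh hh0 (sq_nonneg _)

/-- **THE CERTIFICATE**: `0.58 ≤ sin²y·(1∕y² + 0.91·y²∕(π−y)⁴)` for `0 < y ≤ π∕2` — `sin y ≥ y − y³∕6` on `(0, 0.9]`, seven pieces of
`[0.9, π∕2]` by `G_piece` with rational endpoint checks. [folklore] -/
theorem G_ge (y : ℝ) (hy0 : 0 < y) (hyπ : y ≤ π / 2) :
    (0.58 : ℝ) ≤ Real.sin y ^ 2 * (1 / y ^ 2 + 0.91 * (y ^ 2 / (π - y) ^ 4)) := by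
  have hπ1 : π < 3.1416 := Real.pi_lt_d4
  have hπy : 0 < π - y := by linarith
  rcases le_or_gt y 0.9 with h09 | h09
  · -- `sin y ≥ y(1 − y²∕6) ≥ 0.865·y`
    have hs : y - y ^ 3 / 6 < Real.sin y := Real.sin_gt_sub_cube hy0
    have hy2 : y ^ 2 ≤ 0.81 := by nlinarith
    have hlin : 0.865 * y ≤ y - y ^ 3 / 6 := by nlinarith
    have h1 : (0.865 * y) ^ 2 ≤ Real.sin y ^ 2 := pow_le_pow_left₀ (by positivity) (hlin.trans hs.le) 2
    have h3 : (0.58 : ℝ) ≤ Real.sin y ^ 2 * (1 / y ^ 2) := by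
      rw [mul_one_div, le_div_iff₀ (by positivity)]
      nlinarith
    have h4 : 0 ≤ Real.sin y ^ 2 * (0.91 * (y ^ 2 / (π - y) ^ 4)) := by positivity
    rw [mul_add]
    linarith
  · rcases le_or_gt y 1.0 with h10 | h10
    · exact le_trans (by norm_num) (G_piece (c₂ := 0.91) (by norm_num) (by norm_num) h09.le h10 hyπ (by norm_num))
    rcases le_or_gt y 1.1 with h11 | h11
    · exact le_trans (by norm_num) (G_piece (c₂ := 0.91) (by norm_num) (by norm_num) h10.le h11 hyπ (by norm_num))
    rcases le_or_gt y 1.2 with h12 | h12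
    · exact le_trans (by norm_num) (G_piece (c₂ := 0.91) (by norm_num) (by norm_num) h11.le h12 hyπ (by norm_num))
    rcases le_or_gt y 1.3 with h13 | h13
    · exact le_trans (by norm_num) (G_piece (c₂ := 0.91) (by norm_num) (by norm_num) h12.le h13 hyπ (by norm_num))
    rcases le_or_gt y 1.4 with h14 | h14
    · exact le_trans (by norm_num) (G_piece (c₂ := 0.91) (by norm_num) (by norm_num) h13.le h14 hyπ (by norm_num))
    rcases le_or_gt y 1.5 with h15 | h15
    · exact le_trans (by norm_num) (G_piece (c₂ := 0.91) (by norm_num) (by norm_num) h14.le h15 hyπ (by norm_num))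
    have h16 : y ≤ 1.5708 := by linarith
    exact le_trans (by norm_num) (G_piece (c₂ := 0.91) (by norm_num) (by norm_num) h15.le h16 hyπ (by norm_num))

/-- **`A + B ≥ 0.58`** for `M ≥ 3`, `0 < y ≤ π∕2`: `A = sin²y∕(M²sin²(y∕M)) ≥ sin²y∕y²` (`M sin(y∕M) ≤ y`) and
`B = sin²y sin²(y∕M)∕(M² sin⁴((π−y)∕M)) ≥ 0.91·sin²y·y²∕(π−y)⁴` (`sin(y∕M) ≥ 0.954·y∕M` for `y∕M ≤ π∕6`, `sin((π−y)∕M) ≤ (π−y)∕M`). [folklore] -/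
theorem core_bound (N : ℕ) (hN : 3 ≤ N) (y : ℝ) (hy0 : 0 < y) (hyπ : y ≤ π / 2) :
    (0.58 : ℝ) ≤ Real.sin y ^ 2 / ((N : ℝ) ^ 2 * Real.sin (y / N) ^ 2)
      + Real.sin y ^ 2 * Real.sin (y / N) ^ 2 / ((N : ℝ) ^ 2 * Real.sin ((π - y) / N) ^ 4) := by
  have hNr : (3 : ℝ) ≤ N := by exact_mod_cast hN
  have hN0 : (0 : ℝ) < N := by linarith
  have hπ1 : π < 3.1416 := Real.pi_lt_d4
  have hπ2 : 3.1415 < π := Real.pi_gt_d4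
  have hz0 : 0 < y / N := div_pos hy0 hN0
  have hzle : y / N ≤ 0.5236 := by
    rw [div_le_iff₀ hN0]; nlinarith
  have hzπ : y / N < π := by linarith
  have hsz : 0 < Real.sin (y / N) := Real.sin_pos_of_pos_of_lt_pi hz0 hzπ
  have hw0 : 0 < (π - y) / N := div_pos (by linarith) hN0
  have hwle : (π - y) / N ≤ π - y := div_le_self (by linarith) (by linarith)
  have hwπ : (π - y) / N < π := by linarith
  have hsw : 0 < Real.sin ((π - y) / N) := Real.sin_pos_of_pos_of_lt_pi hw0 hwπ
  -- `A ≥ sin²y ∕ y²`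
  have hA : Real.sin y ^ 2 / y ^ 2 ≤ Real.sin y ^ 2 / ((N : ℝ) ^ 2 * Real.sin (y / N) ^ 2) := by
    refine div_le_div_of_nonneg_left (sq_nonneg _) (by positivity) ?_
    have h1 : (N : ℝ) * Real.sin (y / N) ≤ y := by
      calc (N : ℝ) * Real.sin (y / N) ≤ N * (y / N) := mul_le_mul_of_nonneg_left (Real.sin_le hz0.le) hN0.le
        _ = y := by field_simp
    have h0 : 0 ≤ (N : ℝ) * Real.sin (y / N) := by positivity
    calc (N : ℝ) ^ 2 * Real.sin (y / N) ^ 2 = ((N : ℝ) * Real.sin (y / N)) ^ 2 := by ring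
      _ ≤ y ^ 2 := pow_le_pow_left₀ h0 h1 2
  -- `sin²(y∕M) ≥ 0.91 (y∕M)²`
  have hsinz : 0.91 * (y / N) ^ 2 ≤ Real.sin (y / N) ^ 2 := by
    have h1 : y / N - (y / N) ^ 3 / 6 < Real.sin (y / N) := Real.sin_gt_sub_cube hz0
    have hz2 : (y / N) ^ 2 ≤ 0.2742 := by nlinarith
    have hlin : 0.954 * (y / N) ≤ y / N - (y / N) ^ 3 / 6 := by nlinarith
    have h3 : (0.954 * (y / N)) ^ 2 ≤ Real.sin (y / N) ^ 2 := pow_le_pow_left₀ (by positivity) (hlin.trans h1.le) 2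
    nlinarith
  -- `sin⁴((π−y)∕M) ≤ ((π−y)∕M)⁴`
  have hsinw : Real.sin ((π - y) / N) ^ 4 ≤ ((π - y) / N) ^ 4 := pow_le_pow_left₀ hsw.le (Real.sin_le hw0.le) 4
  have hB : 0.91 * (Real.sin y ^ 2 * (y ^ 2 / (π - y) ^ 4))
      ≤ Real.sin y ^ 2 * Real.sin (y / N) ^ 2 / ((N : ℝ) ^ 2 * Real.sin ((π - y) / N) ^ 4) := by
    have hkey : 0.91 * (Real.sin y ^ 2 * (y ^ 2 / (π - y) ^ 4))
        = Real.sin y ^ 2 * (0.91 * (y / N) ^ 2) / ((N : ℝ) ^ 2 * ((π - y) / N) ^ 4) := by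
      field_simp
    rw [hkey]
    exact div_le_div₀ (by positivity) (mul_le_mul_of_nonneg_left hsinz (sq_nonneg _)) (by positivity)
      (mul_le_mul_of_nonneg_left hsinw (by positivity))
  calc (0.58 : ℝ) ≤ Real.sin y ^ 2 * (1 / y ^ 2 + 0.91 * (y ^ 2 / (π - y) ^ 4)) := G_ge y hy0 hyπ
    _ = Real.sin y ^ 2 / y ^ 2 + 0.91 * (Real.sin y ^ 2 * (y ^ 2 / (π - y) ^ 4)) := by ring
    _ ≤ _ := add_le_add hA hB

/-! ## §2. The near-central pair in the tree's letters: `X_M(p) ≥ Π_μ Σ_j u_jρ_j ≥ 0.58^d` -/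

/-- `S_ξ(x + 2πj) > 0` for `1 ≤ j < M`, `|x| ≤ π` (the shifted half-angle lies in `[π∕2M, π − π∕2M] ⊂ (0, π)`). [folklore] -/
theorem Sxir_shift_pos (N j : ℕ) (hj1 : 1 ≤ j) (hjN : j < N) (x : ℝ) (hx : |x| ≤ π) : 0 < Sxir N (x + 2 * π * j) := by
  have hπ := Real.pi_pos
  have hN : (1 : ℝ) ≤ N := by exact_mod_cast (le_trans hj1 hjN.le)
  have hj1' : (1 : ℝ) ≤ j := by exact_mod_cast hj1
  have hjN' : (j : ℝ) + 1 ≤ N := by exact_mod_cast hjN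
  rw [Sxir_eq]
  have hxl := (abs_le.mp hx).1
  have hxu := (abs_le.mp hx).2
  have h0 : 0 < (x + 2 * π * j) / (2 * N) := div_pos (by nlinarith) (by positivity)
  have h1 : (x + 2 * π * j) / (2 * N) < π := by
    rw [div_lt_iff₀ (by positivity)]; nlinarith
  have := Real.sin_pos_of_pos_of_lt_pi h0 h1
  positivity

/-- `(a∕b)·b ≤ a` for `0 ≤ a` (with `x∕0 = 0`). [folklore] -/
theorem div_mul_le_of_nonneg {a : ℝ} (b : ℝ) (ha : 0 ≤ a) : a / b * b ≤ a := by
  rcases eq_or_ne b 0 with h | h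
  · rw [h, mul_zero]; exact ha
  · rw [div_mul_cancel₀ a h]

/-- **`R_k ≥ Π_μ ρ_μ(k_μ)` for EVERY block side** (`ρ(0) = 1`, `ρ(j) = S_ξ(x)∕S_ξ(x+2πj) ≤ 1` by (40) `Sxir_shift_ge`). [folklore] -/
theorem Rr_ge_prod (N : ℕ) [NeZero N] (k : Fin d → Fin N) (s : Fin d → ℝ) (hs : s ∈ BZ d) :
    ∏ μ, (if (k μ : ℕ) = 0 then (1 : ℝ) else Sxir N (s μ) / Sxir N (s μ + 2 * π * (k μ : ℕ))) ≤ Rr N k s := by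
  classical
  have hsμ : ∀ μ, |s μ| ≤ π := fun μ => abs_le.mpr ⟨hs.1 μ, hs.2 μ⟩
  by_cases hk : k = fun _ => (0 : Fin N)
  · subst hk
    simp [Rr]
  · unfold Rr
    rw [if_neg hk]
    unfold DeltaXir
    rw [add_zero, add_zero]
    obtain ⟨ν, hν⟩ := Function.ne_iff.mp hk
    have hν1 : 1 ≤ (k ν : ℕ) := Nat.one_le_iff_ne_zero.mpr fun h => hν (Fin.ext h)
    refine prod_le_sum_div_sum (fun μ => Sxir N (s μ)) (fun μ => Sxir N (shiftr N k s μ)) _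
      (fun μ => ?_) (fun μ => ?_) (fun μ => ?_) (fun μ => Sxir_nonneg N _) ?_
    · split_ifs
      · exact zero_le_one
      · exact div_nonneg (Sxir_nonneg N _) (Sxir_nonneg N _)
    · split_ifs with h
      · exact le_rfl
      · exact div_le_one_of_le₀ (Sxir_shift_ge N (k μ) (k μ).isLt (s μ) (hsμ μ)) (Sxir_nonneg N _)
    · simp only [shiftr]
      split_ifs with h
      · rw [h, Nat.cast_zero, mul_zero, add_zero, one_mul]
      · exact div_mul_le_of_nonneg _ (Sxir_nonneg N _)
    · refine Finset.sum_pos' (fun μ _ => Sxir_nonneg N _) ⟨ν, Finset.mem_univ ν, ?_⟩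
      simp only [shiftr]
      exact Sxir_shift_pos N (k ν) hν1 (k ν).isLt (s ν) (hsμ ν)

/-- **`X_M(p) ≥ Π_μ Σ_{j<M} u_j(p_μ)ρ_j(p_μ)` for EVERY block side**: all `M^d` aliases kept, `U_k = Π_μ u(k_μ)`, `R_k ≥ Π_μ ρ(k_μ)`, and
the sum over `k` of the products is the product of the coordinate sums. [folklore] -/
theorem Xr_ge_prod_letter (N : ℕ) [NeZero N] (s : Fin d → ℝ) (hs : s ∈ BZ d) :
    ∏ μ, ∑ j : Fin N, uFactorr N (j : ℕ) (s μ) *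
        (if (j : ℕ) = 0 then (1 : ℝ) else Sxir N (s μ) / Sxir N (s μ + 2 * π * (j : ℕ))) ≤ Xr N s := by
  classical
  rw [Finset.prod_univ_sum, Fintype.piFinset_univ]
  unfold Xr
  refine Finset.sum_le_sum fun k _ => ?_
  have hU : Ur N k s = ∏ μ, uFactorr N (k μ : ℕ) (s μ) := rfl
  rw [Finset.prod_mul_distrib, ← hU]
  exact mul_le_mul_of_nonneg_left (Rr_ge_prod N k s hs) (Ur_nonneg N k s)

/-- each letter term `u_j(x)ρ_j(x)` is nonnegative. [folklore] -/
theorem letter_term_nonneg (N : ℕ) (j : ℕ) (x : ℝ) :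
    0 ≤ uFactorr N j x * (if j = 0 then (1 : ℝ) else Sxir N x / Sxir N (x + 2 * π * j)) := by
  refine mul_nonneg (uFactorr_nonneg N j x) ?_
  split_ifs
  · exact zero_le_one
  · exact div_nonneg (Sxir_nonneg N _) (Sxir_nonneg N _)

/-- the central term plus the term of an alias `j ≥ 1` whose shifted half-angle has `sin² = sin²((π−y)∕M)` is `A + B` at `y`
(`y = |x|∕2`; `j = M−1` for `x > 0`, `j = 1` for `x < 0`). [folklore] -/
theorem two_terms_eq (N j : ℕ) (hN : 3 ≤ N) (hj : j ≠ 0) (x y : ℝ) (hx0 : x ≠ 0) (hy0 : 0 < y) (hyπ : y ≤ π / 2)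
    (hsx : Real.sin (x / 2) ^ 2 = Real.sin y ^ 2) (hsxN : Real.sin (x / (2 * N)) ^ 2 = Real.sin (y / N) ^ 2)
    (hsh : Real.sin ((x + 2 * π * j) / (2 * N)) ^ 2 = Real.sin ((π - y) / N) ^ 2) :
    uFactorr N 0 x * 1 + uFactorr N j x * (Sxir N x / Sxir N (x + 2 * π * j))
      = Real.sin y ^ 2 / ((N : ℝ) ^ 2 * Real.sin (y / N) ^ 2)
        + Real.sin y ^ 2 * Real.sin (y / N) ^ 2 / ((N : ℝ) ^ 2 * Real.sin ((π - y) / N) ^ 4) := by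
  have hNr : (3 : ℝ) ≤ N := by exact_mod_cast hN
  have hN0 : (0 : ℝ) < N := by linarith
  have hπ1 : π < 3.1416 := Real.pi_lt_d4
  have hsz : 0 < Real.sin (y / N) := Real.sin_pos_of_pos_of_lt_pi (div_pos hy0 hN0)
    (by have := div_le_self hy0.le (by linarith : (1:ℝ) ≤ N); linarith)
  have hsw : 0 < Real.sin ((π - y) / N) := Real.sin_pos_of_pos_of_lt_pi (div_pos (by linarith) hN0)
    (by have := div_le_self (by linarith : 0 ≤ π - y) (by linarith : (1:ℝ) ≤ N); linarith)
  unfold uFactorr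
  simp only [if_true, if_neg hx0, if_neg hj]
  rw [S1r_eq, Sxir_eq, Sxir_eq, hsx, hsxN, hsh, mul_one]
  field_simp

/-- **the coordinate letter is at least `0.58`** for `M ≥ 3`, `|x| ≤ π`: keep the central alias and its mirror. [folklore] -/
theorem letter_ge (N : ℕ) [NeZero N] (hN : 3 ≤ N) (x : ℝ) (hx : |x| ≤ π) :
    (0.58 : ℝ) ≤ ∑ j : Fin N, uFactorr N (j : ℕ) x *
        (if (j : ℕ) = 0 then (1 : ℝ) else Sxir N x / Sxir N (x + 2 * π * (j : ℕ))) := by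
  classical
  have hπ := Real.pi_pos
  have hN1 : 1 < N := by omega
  -- the two distinguished indices
  set j0 : Fin N := ⟨0, by omega⟩ with hj0
  rcases lt_trichotomy x 0 with hneg | h0 | hpos
  · -- mirror alias `j = 1`
    set j1 : Fin N := ⟨1, hN1⟩ with hj1
    have hne : j0 ≠ j1 := by simp [hj0, hj1, Fin.ext_iff]
    have hsub : ({j0, j1} : Finset (Fin N)) ⊆ Finset.univ := Finset.subset_univ _
    refine le_trans ?_ (Finset.sum_le_sum_of_subset_of_nonneg hsub fun j _ _ => letter_term_nonneg N j x)
    rw [Finset.sum_pair hne]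
    simp only [hj0, hj1, Fin.val_mk, if_true, one_ne_zero, if_false]
    set y : ℝ := -x / 2 with hy
    have hy0 : 0 < y := by rw [hy]; linarith
    have hyπ : y ≤ π / 2 := by have := (abs_le.mp hx).1; rw [hy]; linarith
    rw [two_terms_eq N 1 hN one_ne_zero x y hneg.ne hy0 hyπ ?_ ?_ ?_]
    · exact core_bound N hN y hy0 hyπ
    · rw [show x / 2 = -y by rw [hy]; ring, Real.sin_neg, neg_sq]
    · rw [show x / (2 * N) = -(y / N) by rw [hy]; ring, Real.sin_neg, neg_sq]
    · push_cast
      rw [show (x + 2 * π * 1) / (2 * N) = (π - y) / N by rw [hy]; field_simp; ring]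
  · -- `x = 0`: the central term alone is `1`
    subst h0
    refine le_trans ?_ (Finset.single_le_sum (f := fun j : Fin N => uFactorr N (j : ℕ) 0 *
      (if (j : ℕ) = 0 then (1 : ℝ) else Sxir N 0 / Sxir N (0 + 2 * π * (j : ℕ))))
      (fun j _ => letter_term_nonneg N (j : ℕ) 0) (Finset.mem_univ j0))
    simp [hj0, uFactorr]
    norm_num
  · -- mirror alias `j = M − 1`
    set jm : Fin N := ⟨N - 1, by omega⟩ with hjm
    have hm0 : (N - 1 : ℕ) ≠ 0 := by omega
    have hne : j0 ≠ jm := by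
      simp only [hj0, hjm, ne_eq, Fin.ext_iff]; omega
    have hsub : ({j0, jm} : Finset (Fin N)) ⊆ Finset.univ := Finset.subset_univ _
    refine le_trans ?_ (Finset.sum_le_sum_of_subset_of_nonneg hsub fun j _ _ => letter_term_nonneg N j x)
    rw [Finset.sum_pair hne]
    simp only [hj0, hjm, Fin.val_mk, if_true, if_neg hm0]
    set y : ℝ := x / 2 with hy
    have hy0 : 0 < y := by rw [hy]; linarith
    have hyπ : y ≤ π / 2 := by have := (abs_le.mp hx).2; rw [hy]; linarith
    have hNr : (3 : ℝ) ≤ N := by exact_mod_cast hN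
    have hcast : ((N - 1 : ℕ) : ℝ) = (N : ℝ) - 1 := by
      rw [Nat.cast_sub (by omega)]; simp
    rw [two_terms_eq N (N - 1) hN hm0 x y hpos.ne' hy0 hyπ ?_ ?_ ?_]
    · exact core_bound N hN y hy0 hyπ
    · rw [hy]
    · rw [show x / (2 * N) = y / N by rw [hy]; ring]
    · rw [hcast, show (x + 2 * π * ((N : ℝ) - 1)) / (2 * N) = π - (π - y) / N by
        rw [hy]; field_simp; ring, Real.sin_pi_sub]

/-- **`X_M(p) ≥ 0.58^d` on the zone for every block side `M ≥ 3`.** [folklore] -/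
theorem Xr_ge_of_three_le (N : ℕ) [NeZero N] (hN : 3 ≤ N) (s : Fin d → ℝ) (hs : s ∈ BZ d) :
    (0.58 : ℝ) ^ d ≤ Xr N s := by
  refine le_trans ?_ (Xr_ge_prod_letter N s hs)
  calc (0.58 : ℝ) ^ d = ∏ _μ : Fin d, (0.58 : ℝ) := by rw [Finset.prod_const, Finset.card_univ, Fintype.card_fin]
    _ ≤ _ := Finset.prod_le_prod (fun _ _ => by norm_num) fun μ _ =>
        letter_ge N hN (s μ) (abs_le.mpr ⟨hs.1 μ, hs.2 μ⟩)

/-! ## §3. The fibre bound and the headline for every block side `M ≥ 3` -/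

/-- **`Σ_τ ‖G_{M,a,0,τ}(p)‖² ≤ M^d·(0.58^d)⁻¹·symbR(p)²`** on the zone, every `M ≥ 3`, `a > 0`. [folklore] -/
theorem sum_normSq_G_le_threeUp (N : ℕ) [NeZero N] (hN : 3 ≤ N) {a : ℝ} (ha : 0 < a) (p : Fin d → ℝ) (hp : p ∈ BZ d) :
    ∑ τ : Fin d → Fin N, ‖G N a 0 τ (ofRealVec p)‖ ^ 2 ≤ (N : ℝ) ^ d * ((0.58 : ℝ) ^ d)⁻¹ * symbR N a p ^ 2 := by
  have hX := Xr_ge_of_three_le N hN p hp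
  have hc : (0 : ℝ) < (0.58 : ℝ) ^ d := by positivity
  have h1 := sum_normSq_G_le_div_Xr N (by omega) ha p hp
  calc ∑ τ : Fin d → Fin N, ‖G N a 0 τ (ofRealVec p)‖ ^ 2 ≤ (N : ℝ) ^ d * (symbR N a p ^ 2 / Xr N p) := h1
    _ ≤ (N : ℝ) ^ d * (symbR N a p ^ 2 / (0.58 : ℝ) ^ d) :=
        mul_le_mul_of_nonneg_left (div_le_div_of_nonneg_left (sq_nonneg _) hc hX) (by positivity)
    _ = (N : ℝ) ^ d * ((0.58 : ℝ) ^ d)⁻¹ * symbR N a p ^ 2 := by rw [div_eq_mul_inv]; ring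

/-- **THE HEADLINE FOR EVERY BLOCK SIDE `M = n + 1 ≥ 3`**: `((n+1)^d)⁻¹ Σ′_z (H B)(z)² ≤ (0.58^d)⁻¹ Σ′_y B(y)²` for every `a > 0` and every
square-summable coarse field `B` — `‖H_M‖²_η ≤ 0.58^{−d}`. [folklore] -/
theorem tsum_HBZd_sq_le_threeUp (n : ℕ) (hn : 2 ≤ n) {a : ℝ} (ha : 0 < a) (Bf : X d → ℝ) (hB : Summable fun x => Bf x ^ 2) :
    (((n : ℝ) + 1) ^ d)⁻¹ * ∑' z : X d, HBZd n a Bf z ^ 2 ≤ ((0.58 : ℝ) ^ d)⁻¹ * ∑' y : X d, Bf y ^ 2 := by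
  have hK0 : 0 ≤ ((0.58 : ℝ) ^ d)⁻¹ := by positivity
  have hK : ∀ p ∈ BZ d, ∑ τ : Fin d → Fin (n + 1), ‖G (n + 1) a 0 τ (ofRealVec p)‖ ^ 2
      ≤ ((n : ℝ) + 1) ^ d * ((0.58 : ℝ) ^ d)⁻¹ * symbR (n + 1) a p ^ 2 := by
    intro p hp
    have h := sum_normSq_G_le_threeUp (n + 1) (by omega) ha p hp
    push_cast at h
    exact h
  have h := tsum_HBZd_sq_le_of_fibre n ha hK0 hK Bf hB
  have hN : (0 : ℝ) < ((n : ℝ) + 1) ^ d := by positivity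
  rw [inv_mul_le_iff₀ hN, ← mul_assoc]
  exact h

/-- **d = 4, every block side `M ≥ 3`**: `((n+1)⁴)⁻¹ Σ′_z (H B)(z)² ≤ 8.84·Σ′_y B(y)²` (`0.58⁻⁴ = 8.836…`), i.e. `‖H_M‖_η < 2.98 < 3 ≤ M =
M^{(d−2)∕2}`: with (44) (`M = 2`) EVERY block side `M ≥ 2` is below the consumer threshold BY PROOF. [folklore] -/
theorem tsum_HBZd_sq_le_threeUp_d4 (n : ℕ) (hn : 2 ≤ n) {a : ℝ} (ha : 0 < a) (Bf : X 4 → ℝ)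
    (hB : Summable fun x => Bf x ^ 2) :
    (((n : ℝ) + 1) ^ 4)⁻¹ * ∑' z : X 4, HBZd n a Bf z ^ 2 ≤ 8.84 * ∑' y : X 4, Bf y ^ 2 := by
  have h := tsum_HBZd_sq_le_threeUp (d := 4) n hn ha Bf hB
  have h0 : 0 ≤ ∑' y : X 4, Bf y ^ 2 := tsum_nonneg fun y => sq_nonneg _
  have hc : ((0.58 : ℝ) ^ 4)⁻¹ < 8.84 := by norm_num
  nlinarith

/-- **THE ONE-SHOT CHART LETTER AT d = 4, EVERY BLOCK SIDE `M = n+1 ≥ 2`**: there is `K < M² = (M^{(d−2)∕2})²` with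
`(M⁴)⁻¹ Σ′_z (H B)(z)² ≤ K·Σ′_y B(y)²` for every `a > 0` and every square-summable `B` — `K = 2.13` at `M = 2` ((44)
`OneShotChartSideTwo.tsum_HBZd_sq_le_sideTwo_d4`), `K = 8.84` for `M ≥ 3` (`tsum_HBZd_sq_le_threeUp_d4`): the consumer's radius letter
`K₁ < M^{(d−2)∕2}` (HRS) is met by the Gaussian one-shot chart of EVERY composite side, BY PROOF. [folklore] -/
theorem chart_letter_d4 (n : ℕ) (hn : 1 ≤ n) {a : ℝ} (ha : 0 < a) (Bf : X 4 → ℝ) (hB : Summable fun x => Bf x ^ 2) :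
    ∃ K : ℝ, K < ((n : ℝ) + 1) ^ 2 ∧
      (((n : ℝ) + 1) ^ 4)⁻¹ * ∑' z : X 4, HBZd n a Bf z ^ 2 ≤ K * ∑' y : X 4, Bf y ^ 2 := by
  rcases Nat.lt_or_ge n 2 with h2 | h2
  · have hn1 : n = 1 := by omega
    subst hn1
    refine ⟨2.13, by norm_num, ?_⟩
    have h := OneShotChartSideTwo.tsum_HBZd_sq_le_sideTwo_d4 ha Bf hB
    norm_num at h ⊢
    exact h
  · refine ⟨8.84, ?_, tsum_HBZd_sq_le_threeUp_d4 n h2 ha Bf hB⟩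
    have h3 : (3 : ℝ) ≤ (n : ℝ) + 1 := by exact_mod_cast (by omega : 3 ≤ n + 1)
    nlinarith

end

end Summit.QuantumFields.BalabanUV.T4Continuum.NE7b.OneShotChartPairBound
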